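import Summits.QuantumAdvantage.QuantumAdvantage.Theorems.WhiteBoxWalkWbwThesis
import Summits.QuantumAdvantage.QuantumAdvantage.Theorems.WhiteBoxWalkWbwThesisBridge
import Literature.Computability.Complexity.IoAvgHardMachine
import Literature.Computability.Complexity.TokenStreams

/-!
# Route `WhiteBoxWalk`, crux `WbwObfuscatedGluedTrees` (stmt-QuantumAdvantage-2340): the typed crux is UNPINNED — data

Part 1 of `FactoringAssumption → WbwObfuscatedGluedTrees` (the theorem is in
`WhiteBoxWalkWbwObfuscatedGluedTreesUnpinned.lean`): the cheating data, the closed forms of the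
instance and the answer, and their polynomial-time plumbing.

The conclusion of `WbwObfuscatedGluedTrees` quantifies `∃ (Λ : Params) (O : CircuitObfuscator)
(P : PuncturablePRFScheme)` with NO pins on the three data (no `IsSubexpIO`, no correctness, no PRF
security or efficiency).  Hence the landed factoring witness `(genPQ, ansPQ)` of
`wbwThesis_of_factoringAssumption` re-dresses as an "obfuscated glued-trees" instance generator:

* `Λ₀`: depth `1`, PRF parameter `μ(n) = n`, key parts of length `n` (so the key material of a seed
  `s ∈ {0,1}ⁿ` is `s` itself, `k₁ = s`, `k₂ = ε`), security parameter and coin length `0`, and the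
  "neighbour circuit" `circ n K :=` the circuit whose gates are the fan-in-`0` constants
  `0, (genPQ K)₀, (genPQ K)₁, …` (its CODE carries `genPQ K`);
* `O₀`: the identity "obfuscator";
* `P₀`: `eval μ k x := prePQ k` if `x` starts with a `1` (the EXIT label `1·0000` does, the ENTRANCE
  label `0⁵` does not), `ε` otherwise.

Then `name(ENTRANCE) = 0ⁿ⁺⁵`, `name(EXIT) = prePQ s ++ 1·0000`,
`gen Λ₀ O₀ P₀ s = ⟨code(n, genPQ s), 0ⁿ⁺⁵⟩`, `ans Λ₀ O₀ P₀ s = fit |gen s| (prePQ s ++ 1·0000)`: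
the generator is polynomial time (`genPQ ∈ FP` and `CodeFP` assembly of the circuit code), ONE
uniform quantum family prints the answer (Shor on the extracted product, wrapped classically:
decode `genPQ s` from the code, re-assemble `ansPQ s`, cut to `prePQ s`, append the label, fit), and a
PPT adversary printing the answer on `⟨1ⁿ, gen s⟩` inverts the one-way `genPQ` (truncate to `n`
symbols after translating the input; the coin budget is translated along the strictly increasing
length map `n ↦ |⟨1ⁿ, genPQ s⟩|`).  No premise of the crux is used: as typed, the crux is dominated by
the registered strong hypothesis `FactoringAssumption` (tribunal rule (a)), exactly like `WbwThesis`.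
-/

noncomputable section

set_option linter.dupNamespace false

namespace Summit.QuantumAdvantage.QuantumAdvantage.Theorems.WhiteBoxWalk

open Summit.QuantumAdvantage.QuantumAdvantage.Theses.WhiteBoxWalk (WbwObfuscatedGluedTrees)
open Summit.QuantumAdvantage.QuantumAdvantage.Theorems (FactoringAssumption)
open Literature.Computability.Cryptography Literature.Computability.Complexity
open Literature.Computability.Cryptography.ObfuscatedGluedTrees
open Literature.Computability.QuantumComplexity (isQSolvable_classicalWrap_dep)
open Literature.Computability.QuantumComplexity.GluedTrees (Vertex entrance exit)
open _root_.Computability Polynomial Filter Asymptotics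

namespace Unpinned

/-! ### §1 The cheating data -/

/-- The fan-in-`0` constant gate `b`. -/
def constGate (N : ℕ) (b : Bool) : Gate (Fin N) := ⟨0, fun _ => b, Fin.elim0⟩

/-- The circuit on `N` inputs whose gates are the constants `0, b₀, b₁, …` (output: gate `0`): its
code carries the string `b`. -/
def bitsCircuit (N : ℕ) (b : List Bool) : Circuit (Fin N) where
  gates := (false :: b).map (constGate N)
  output := .inr 0
  wf := by
    intro j hj a
    simp only [List.getElem_map] at a
    exact a.elim0
  wf_output := by
    intro m hm
    cases hm
    simp

/-- The EXIT label at depth `1`: `1·0000`. -/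
def ell : List Bool := [true, false, false, false, false]

/-- `Λ₀`. -/
def Lam : Params where
  depth := fun _ => 1
  depth_pos := fun _ => Nat.one_pos
  prfParam := fun n => n
  keyPartLen := fun n => n
  secParam := fun _ => 0
  coinLen := fun _ => 0
  circ := fun _ K => bitsCircuit _ (genPQ K)

/-- `O₀`: the identity. -/
def Obf : CircuitObfuscator := ⟨fun _ _ C _ => C, fun _ => 0⟩

/-- `P₀`: prints `prePQ k` on inputs starting with `1`. -/
def Prf : PuncturablePRFScheme where
  eval := fun _ k x => if x.head? = some true then prePQ k else []
  punc := fun _ _ _ => []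
  peval := fun _ _ _ => []
  keyLen := fun _ => 0
  pkeyLen := fun _ => 0
  inLen := fun _ => 0
  outLen := fun _ => 0

/-! ### §2 Closed forms of the names, the instance and the answer -/

/-- `|prePQ s| = |s|` (`stub_canon`). -/
theorem length_prePQ (s : List Bool) : (prePQ s).length = s.length := (stub_canon s).2.1

/-- `prePQ ε = ε`. -/
theorem prePQ_nil : prePQ [] = [] := List.eq_nil_of_length_eq_zero (length_prePQ [])

/-- The key material of a seed is the seed. -/
theorem keyMaterial_eq (s : List Bool) : Lam.keyMaterial s = s := by
  simp only [Params.keyMaterial, Lam]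
  exact List.take_of_length_le (by omega)

/-- `k₁ = s`. -/
theorem key_zero (s : List Bool) : Lam.key s.length s 0 = s := by
  simp [Params.key, Lam]

/-- `k₂ = ε`. -/
theorem key_one (s : List Bool) : Lam.key s.length s 1 = [] := by
  simp [Params.key, Lam]

/-- The EXIT label at depth `1` is `1·0000`. -/
theorem label_exit_one : label 1 (exit 1) = ell := by
  have hb : bitsOf 2 0 = [false, false] := by simp [bitsOf]
  show true :: (bitsOf (1 + 1) 0 ++ bitsOf (1 + 1) 0) = ell
  rw [hb]; rfl

/-- `fit n x` never starts with a `1` when `x` starts with a `0` or is empty… specialised: `fit n 0⁵`. -/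
theorem head?_fit_replicate (n m : ℕ) : (fit n (List.replicate m false)).head? ≠ some true := by
  cases n with
  | zero => simp [fit]
  | succ n =>
    cases m with
    | zero => simp [fit, List.replicate_succ]
    | succ m => simp [fit, List.replicate_succ]

/-- `P₀` prints `ε` on inputs not starting with a `1`. -/
theorem eval_Prf_of_ne (μ : ℕ) (k x : List Bool) (h : x.head? ≠ some true) : Prf.eval μ k x = [] := by
  simp [Prf, h]

/-- The tag of the all-zero label is `0ⁿ`. -/
theorem tag_zeros (s : List Bool) (m : ℕ) :
    tag Prf s.length s (List.replicate m false) = List.replicate s.length false := by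
  rw [tag, prf, eval_Prf_of_ne _ _ _ (head?_fit_replicate _ _)]
  simp [fit]

/-- Every mask (key `k₂ = ε`) is `0⁵`… in general `0^m`. -/
theorem prf_nil (μ m : ℕ) (x : List Bool) : prf Prf μ [] m x = List.replicate m false := by
  rw [prf]
  have : Prf.eval μ [] (fit μ x) = [] := by
    unfold Prf
    dsimp only
    split <;> simp [prePQ_nil]
  rw [this]
  simp [fit]

/-- The tag of the EXIT label is `prePQ s`. -/
theorem tag_ell (s : List Bool) : tag Prf s.length s ell = prePQ s := by
  rw [tag, prf]
  rcases Nat.eq_zero_or_pos s.length with h0 | hpos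
  · rw [h0]
    have : prePQ s = [] := List.eq_nil_of_length_eq_zero (by rw [length_prePQ, h0])
    simp [fit, this]
  · have hfit : (fit s.length ell).head? = some true := by
      obtain ⟨n, hn⟩ := Nat.exists_eq_succ_of_ne_zero hpos.ne'
      rw [hn]; simp [fit, ell]
    have : Prf.eval s.length s (fit s.length ell) = prePQ s := by simp [Prf, hfit]
    rw [this, fit_of_length_eq (length_prePQ s)]

/-- Masking by zeros is the identity. -/
theorem bxor_replicate_false_right (x : List Bool) : bxor x (List.replicate x.length false) = x := by
  induction x with
  | nil => simp [bxor]
  | cons b x ih =>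
    simp only [List.length_cons, List.replicate_succ, bxor, List.zipWith_cons_cons, Bool.xor_false,
      List.cons.injEq, true_and]
    exact ih

/-- `name(ENTRANCE) = 0ⁿ⁺⁵`. -/
theorem entranceName_eq (s : List Bool) :
    Lam.entranceName Prf s.length s = List.replicate (s.length + 5) false := by
  rw [FPData.entranceName_eq (Λ := Lam) (P := Prf), key_zero, key_one]
  show tag Prf s.length s (List.replicate (labelLen 1) false) ++
      prf Prf s.length [] (labelLen 1) (tag Prf s.length s (List.replicate (labelLen 1) false)) = _
  rw [tag_zeros, prf_nil, ← List.replicate_add]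
  rfl

/-- `name(EXIT) = prePQ s ++ 1·0000`. -/
theorem exitName_eq (s : List Bool) : Lam.exitName Prf s.length s = prePQ s ++ ell := by
  rw [Params.exitName, Params.nameOfVertex, key_zero, key_one]
  show sivEnc Prf s.length s [] (label 1 (exit 1)) = _
  rw [label_exit_one, sivEnc, tag_ell, prf_nil]
  show prePQ s ++ bxor ell (List.replicate ell.length false) = _
  rw [bxor_replicate_false_right]

/-- The sized instance circuit. -/
theorem instCircuit_eq (s : List Bool) :
    Lam.instCircuit Obf s.length (Lam.keyMaterial s) (Lam.coins s) =
      ⟨(s.length + 5) + (s.length + 5), bitsCircuit _ (genPQ s)⟩ := by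
  rw [keyMaterial_eq]; rfl

/-- `gen Λ₀ O₀ P₀ s = ⟨code(n, genPQ s), 0ⁿ⁺⁵⟩`. -/
theorem gen_eq (s : List Bool) :
    gen Lam Obf Prf s = boolPair (encodeSizedCircuit ⟨(s.length + 5) + (s.length + 5), bitsCircuit _ (genPQ s)⟩)
      (List.replicate (s.length + 5) false) := by
  rw [gen, instCircuit_eq, keyMaterial_eq, entranceName_eq]

/-- `ans Λ₀ O₀ P₀ s = fit |gen s| (prePQ s ++ 1·0000)`. -/
theorem ans_eq (s : List Bool) : ans Lam Obf Prf s = fit (gen Lam Obf Prf s).length (prePQ s ++ ell) := by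
  rw [ans, keyMaterial_eq, exitName_eq]

/-- `|gen s| ≥ n + 5`. -/
theorem le_length_gen (s : List Bool) : s.length + 5 ≤ (gen Lam Obf Prf s).length := by
  rw [gen_eq, length_boolPair, List.length_replicate]; omega

/-- The answer starts with `prePQ s`. -/
theorem prePQ_prefix_ans (s : List Bool) : prePQ s <+: ans Lam Obf Prf s := by
  rw [ans_eq, fit_eq_append_of_le (by rw [List.length_append, length_prePQ]; exact le_length_gen s), List.append_assoc]
  exact List.prefix_append _ _

/-! ### §3 The typed view of the instance and its code -/

section Typed

open CodeFP

/-- The typed view of an instance: `((2N, (gate items, output wire)), name(ENTRANCE))`, a gate item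
being `(bit, ε)` (code `boolPair [bit] ε`, the code of the constant gate `bit`). -/
abbrev CodeT : Type := (ℕ × (List (Bool × List Bool) × List Bool)) × List Bool

/-- The encoder of the typed view (its value on `viewOf n b` is the instance string). -/
abbrev codeE : CodeT → List Bool := pairE (pairE natE (pairE (rawE (pairE bitE strE)) strE)) strE

/-- The gate items of the bits `b`: `(0, ε), (b₀, ε), (b₁, ε), …`. -/
def pairsOf (b : List Bool) : List (Bool × List Bool) := (false :: b).map fun bit => (bit, [])

/-- The typed view of the instance with parameter `n` carrying the bits `b`. -/
abbrev viewOf (n : ℕ) (b : List Bool) : CodeT :=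
  ((n + 5 + (n + 5), (pairsOf b, [true])), List.replicate (n + 5) false)

/-- The code of a constant gate is `boolPair [bit] ε`. -/
theorem encodeGate_constGate (N : ℕ) (bit : Bool) :
    Literature.Computability.QuantumComplexity.encodeGate (constGate N bit) = boolPair [bit] [] := by
  simp [Literature.Computability.QuantumComplexity.encodeGate, constGate,
    Literature.Computability.MetaComplexity.truthTable, Literature.Computability.QuantumComplexity.encodeCodeList]

/-- The code list of the constant gates of `l` is the raw code of the items `(bit, ε)`. -/
theorem encodeCodeList_constGates (N : ℕ) (l : List Bool) :
    Literature.Computability.QuantumComplexity.encodeCodeList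
        ((l.map (constGate N)).map Literature.Computability.QuantumComplexity.encodeGate) =
      rawE (pairE bitE strE) (l.map fun bit => (bit, ([] : List Bool))) := by
  induction l with
  | nil => rfl
  | cons b l ih =>
    simp only [List.map_cons, rawE_cons, pairE_apply]
    show boolPair _ (Literature.Computability.QuantumComplexity.encodeCodeList _) = _
    rw [ih, encodeGate_constGate]
    rfl

/-- **The instance is the code of its typed view.** -/
theorem gen_eq_codeE (s : List Bool) : gen Lam Obf Prf s = codeE (viewOf s.length (genPQ s)) := by
  rw [gen_eq]
  show boolPair (boolPair (encodeNat (s.length + 5 + (s.length + 5)))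
    (boolPair (Literature.Computability.QuantumComplexity.encodeCodeList
      (((false :: genPQ s).map (constGate _)).map Literature.Computability.QuantumComplexity.encodeGate))
    (true :: encodeNat 0))) (List.replicate (s.length + 5) false) = _
  rw [encodeCodeList_constGates, TokConv.encodeNat_zero']
  rfl

/-- `genPQ ∈ FP` (Yao's product of the polynomial-time `fPQ`). -/
theorem genPQ_mem_FP : genPQ ∈ FP := yaoFun_polyTime_holds pqParams stub_fPQ_polyTime

/-- **The typed view is computed on codes**: `(1ⁿ, b) ↦ viewOf n b`. -/
theorem viewFP : CodeFP (pairE unE strE) codeE (fun p => viewOf p.1 p.2) := by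
  have hn : CodeFP (pairE unE strE) unE (fun p => p.1 + 5) :=
    (unSucc.comp (unSucc.comp (unSucc.comp (unSucc.comp (unSucc.comp (fst unE strE)))))).congr fun _ => by
      omega
  have hN : CodeFP (pairE unE strE) unE (fun p => p.1 + 5 + (p.1 + 5)) := unAdd.comp (hn.pair hn)
  have hk : CodeFP (pairE unE strE) natE (fun p => p.1 + 5 + (p.1 + 5)) := (natOfUn.comp hN).congr fun _ => rfl
  have hb : CodeFP (pairE unE strE) (rawE bitE) (fun p => false :: p.2) :=
    (rawCons bitE).comp ((const _ false).pair (IoHard.codeFP_strToRaw.comp (snd unE strE)))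
  have hitem : CodeFP bitE (pairE bitE strE) (fun bit => (bit, ([] : List Bool))) :=
    (CodeFP.id bitE).pair (const bitE ([] : List Bool))
  have hpairs : CodeFP (pairE unE strE) (rawE (pairE bitE strE)) (fun p => pairsOf p.2) :=
    ((map₀ hitem).comp hb).congr fun _ => rfl
  have hout : CodeFP (pairE unE strE) strE (fun _ => [true]) := const _ _
  have hz : CodeFP (pairE unE strE) strE (fun p => List.replicate (p.1 + 5) false) := FPData.zeros.comp hn
  exact (hk.pair (hpairs.pair hout)).pair hz

/-- **The generator is polynomial time.** -/
theorem polyTime_gen : PolyTimeComputable (id : List Bool → List Bool) id (gen Lam Obf Prf) := by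
  have hg : CodeFP strE strE genPQ := of_fn genPQ genPQ_mem_FP fun _ => rfl
  have h := viewFP.comp (strLength.pair hg)
  have h' : CodeFP strE strE (gen Lam Obf Prf) := h.recodeOut fun s => (gen_eq_codeE s).symm
  exact h'.polyTimeComputable

/-- **The input translation of the reduction**: an `FP` function with
`GEN ⟨1ⁿ, x⟩ = ⟨1ⁿ, code of the view (n, x)⟩`, so `GEN ⟨1ⁿ, genPQ s⟩ = ⟨1ⁿ, gen s⟩` for `|s| = n`. -/
theorem GEN_exists : ∃ GEN : List Bool → List Bool, GEN ∈ FP ∧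
    ∀ (n : ℕ) (x : List Bool), GEN (boolPair (unaryEncodeNat n) x) = boolPair (unaryEncodeNat n) (codeE (viewOf n x)) := by
  obtain ⟨GEN, hGEN, hspec⟩ := (fst unE strE).pair viewFP
  exact ⟨GEN, hGEN, fun n x => hspec (n, x)⟩

/-- **The decoder**: an `FP` function with `pre (gen s) = genPQ s`. -/
theorem pre_exists : ∃ pre : List Bool → List Bool, pre ∈ FP ∧ ∀ s, pre (gen Lam Obf Prf s) = genPQ s := by
  have hl : CodeFP codeE (rawE (pairE bitE strE)) (fun v => v.1.2.1) := ((fst _ _).snd').fst'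
  have h : CodeFP codeE strE (fun v => (v.1.2.1.map Prod.fst).tail) :=
    bitsToStr.comp ((rawTail bitE).comp ((map₀ (fst bitE strE)).comp hl))
  obtain ⟨pre, hpre, hspec⟩ := h
  refine ⟨pre, hpre, fun s => ?_⟩
  rw [gen_eq_codeE, hspec]
  simp only [pairsOf, List.map_cons, List.map_map, List.tail_cons, Function.comp_def, List.map_id']
  rfl

/-- **The post-processing**: `⟨x, a⟩ ↦ fit |x| (fit n a ++ 1·0000)` with `n = |name part of x| - 5`,
after the re-assembly `g₁` on the decoded instance. -/
theorem post_exists {g₁ pre : List Bool → List Bool} (hg₁ : g₁ ∈ FP) (hpre : pre ∈ FP) :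
    ∃ g₂ : List Bool → List Bool, g₂ ∈ FP ∧ ∀ x y,
      g₂ (boolPair x y) = fit x.length (fit ((Brick.sndF x).drop 5).length (g₁ (boolPair (pre x) y)) ++ ell) := by
  have hx : CodeFP (pairE strE strE) strE Prod.fst := fst _ _
  have ha : CodeFP (pairE strE strE) strE Prod.snd := snd _ _
  have hsndF : CodeFP strE strE Brick.sndF := of_fn Brick.sndF Brick.sndF_mem_FP fun _ => rfl
  have hdrop : CodeFP (pairE strE strE) strE (fun p => (Brick.sndF p.1).drop 5) :=
    strDrop.comp ((const _ (5 : ℕ)).pair (hsndF.comp hx))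
  have hfit : CodeFP (pairE strE strE) strE (fun p => fit ((Brick.sndF p.1).drop 5).length p.2) :=
    FPData.fitFP.comp ((strLength.comp hdrop).pair ha)
  have happ : CodeFP (pairE strE strE) strE (fun p => fit ((Brick.sndF p.1).drop 5).length p.2 ++ ell) :=
    strAppend.comp (hfit.pair (const _ ell))
  have hG : CodeFP (pairE strE strE) strE
      (fun p => fit p.1.length (fit ((Brick.sndF p.1).drop 5).length p.2 ++ ell)) :=
    FPData.fitFP.comp ((strLength.comp hx).pair happ)
  obtain ⟨G, hGFP, hGeq⟩ := hG
  refine ⟨G ∘ fanoutFn Brick.fstF (g₁ ∘ mapFstFn pre),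
    comp_mem_FP hGFP (fanoutFn_mem_FP Brick.fstF_mem_FP (comp_mem_FP hg₁ (mapFstFn_mem_FP hpre))), fun x y => ?_⟩
  have := hGeq (x, g₁ (boolPair (pre x) y))
  simp only [pairE_apply] at this
  simp only [Function.comp_apply, fanoutFn_apply, Brick.fstF_boolPair, mapFstFn_boolPair]
  exact this

end Typed

end Unpinned

end Summit.QuantumAdvantage.QuantumAdvantage.Theorems.WhiteBoxWalk

end
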